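import Mathlib
import Literature.Combinatorics.Extremal.LowDegreeSurfaceThroughLines
import HarnessLib

/-!
# The finite-field Kakeya theorem (Dvir 2009, Theorems 1.5 and 1.4)

Topic `Literature/Combinatorics/Kakeya`.  Everything in this file is PROVED (no named fact, no
`sorry`).  Companion to the Tao 2005 files of this directory (the quadric obstruction in `𝔽_q⁴`):
Dvir's polynomial-method lower bound for Kakeya sets in `𝔽_qⁿ`, which settled the finite-field
Kakeya problem raised by Wolff.

Z. Dvir, *On the size of Kakeya sets in finite fields*, J. Amer. Math. Soc. **22** (2009), no. 4,
1093–1097 (doi:10.1090/S0894-0347-08-00607-3; arXiv:0803.2336), verbatim from the printed text: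

> (§1, p. 1093) Let `𝔽` denote a finite field of `q` elements. A *Kakeya set* (also called a
> Besicovitch set) in `𝔽ⁿ` is a set `K ⊂ 𝔽ⁿ` such that `K` contains a line in every direction.
> More formally, `K` is a Kakeya set if for every `x ∈ 𝔽ⁿ` there exists a point `y ∈ 𝔽ⁿ` such
> that the line `L_{y,x} ≜ {y + a · x | a ∈ 𝔽}` is contained in `K`.
>
> (p. 1094) **Theorem 1.5.** Let `K ⊂ 𝔽ⁿ` be a Kakeya set. Then `|K| ≥ C_n · qⁿ`, where `C_n`
> depends only on `n`.

(§1.1, p. 1094: "Following the initial publication of this work, Noga Alon and Terence Tao [AT08]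
independently observed that it is possible to turn the proof of Theorem 1.1" — the bound
`|K| ≥ C_n · q^{n−1}` — "into a proof that gives a bound of `C_n · qⁿ`, thus achieving an optimal
bound."  The arXiv version numbers the same statement Theorem 3.)

The printed proof (§3, p. 1096) gives the explicit form which is the statement formalized here:

> Suppose, by contradiction, that `K ⊂ 𝔽ⁿ` is a Kakeya set such that `|K| < C(q + n − 1, n)`.
> Then […] there exists a nonzero polynomial `g ∈ 𝔽[x₁, …, xₙ]` of degree `d ≤ q − 1` so that
> `g(x) = 0` for all `x ∈ K` […]. Let `ḡ` be the homogeneous part of degree `d` of `g` so that `ḡ`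
> is nonzero and homogeneous. Fix some `y ∈ 𝔽ⁿ`. Then there exists `z ∈ 𝔽ⁿ` so that the line
> `{z + t · y | t ∈ 𝔽}` is contained in `K`. Therefore, `P_{y,z}(t) ≜ g(z + t · y) = 0` for all
> `t ∈ 𝔽`. Since `P_{y,z}(t)` is a univariate polynomial of degree `d ≤ q − 1` this means that
> `P_{y,z}(t)` is identically zero, and hence all its coefficients are zero. In particular, the
> coefficient of `t^d` is zero, but it is easy to see that this is exactly `ḡ(y)`. Since `y` is
> arbitrary it follows that the polynomial `ḡ` is identically zero – a contradiction.

## What is proved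

* `IsKakeya S` (def) — Dvir's definition, for `S ⊆ 𝔽ⁿ = (Fin n → K)`.
* `choose_le_card` — **Theorem 1.5 in the explicit form of its proof: every Kakeya set
  `S ⊆ 𝔽_qⁿ` has `|S| ≥ C(q + n − 1, n)`** (`K` any finite field, any `n`).
* `pow_le_factorial_mul_card` — hence `qⁿ ≤ n! · |S|`, i.e. Theorem 1.5 with `C_n = 1 / n!`
  (`C(q + n − 1, n) = q (q + 1) ⋯ (q + n − 1) / n! ≥ qⁿ / n!`); `choose_le_ncard`,
  `pow_le_factorial_mul_ncard` — the same for `Set`s.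
* `IsDeltaGammaKakeya δ γ S` (def) — Definition 1.3 (p. 1094): some set `ℒ` of at least `δ qⁿ`
  directions `x`, each with a line `{z + a x}` meeting `S` in at least `γ q` points.
* `choose_le_card_of_isDeltaGammaKakeya` — **Theorem 1.4: a `(δ, γ)`-Kakeya set has
  `|S| ≥ C(d + n − 1, n − 1)` whenever `d + 2 ≤ q min{δ, γ}`**;
  `choose_floor_le_card_of_isDeltaGammaKakeya` — the printed choice `d = ⌊q min{δ, γ}⌋ − 2`;
  `choose_le_ncard_of_isDeltaGammaKakeya` — for `Set`s.  (Printed: "Theorem 1.4. Let `K ⊂ 𝔽ⁿ`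
  be a `(δ, γ)`-Kakeya set. Then `|K| ≥ C(d + n − 1, n − 1)`, where `d = ⌊q · min{δ, γ}⌋ − 2`.")

The proof follows the printed one step by step: `exists_mvPolynomial_eval_eq_zero` (a nonzero
`g` of degree `≤ d` vanishing on `S` as soon as `|S| < C(d + n, n) = dim {g : deg g ≤ d}`, by
linear algebra), `coeff_aeval_line` (the coefficient of `t^d` in `g(z + t y)` is `ḡ(y)` when
`d = deg g`), `homogeneousComponent_totalDegree_ne_zero` (`ḡ ≠ 0`), and, for the last sentence
("`ḡ(y) = 0` for every `y`, hence `ḡ = 0`", which uses `deg ḡ ≤ q − 1 < q`),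
`exists_eval_ne_zero_of_totalDegree_lt`, obtained here from the Schwartz–Zippel lemma (Dvir's
Lemma 2.1; Mathlib's `MvPolynomial.schwartz_zippel_totalDegree`).  The restriction of a polynomial
to a line and its vanishing (`P_{y,z} ≡ 0`) are taken from
`Literature.Combinatorics.Extremal.LowDegreeSurfaceThroughLines`
(`aeval_line_eq_zero_of_totalDegree_lt_card`, `eval_aeval_line`).  For Theorem 1.4 (§2):
`exists_isHomogeneous_eval_eq_zero` (a nonzero HOMOGENEOUS `g` of degree `d` vanishing on `S` when
`|S| < C(n + d − 1, d)` = the number of monomials of degree `d`), `card_zeros_mul_card_le`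
(Lemma 2.1, Schwartz–Zippel: `#{g = 0} · q ≤ deg g · qⁿ`); Claim 2.2 ("`g(y) = 0` for every
`y ∈ ℒ`") is obtained from the top-coefficient identity of §3 (`coeff_aeval_line_of_isHomogeneous`:
for homogeneous `g` of degree `d` the `a^d`-coefficient of `g(z + a y)` is `g(y)`) rather than
from the printed cone `K' = {c x}` and the inversion `b_i = a_i⁻¹` — a shorter road to the same
claim, which moreover needs only `d + 1` points on the line.

## Not in this file

* Corollary 1.2 (the product trick) and Theorem 1.1 (`|K| ≥ C_n q^{n−1}`), both superseded by
  Theorem 1.5; the remark "Theorem 1.1 will follow by setting `δ = γ = 1`" (with Definition 1.3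
  read literally, the direction `x = 0` has to be left out of `ℒ`, so a Kakeya set is a
  `(1 − q^{−n}, 1)`-Kakeya set).
* The later improvements of the constant (Saraf–Sudan, Dvir–Kopparty–Saraf–Sudan: `|K| ≥ qⁿ / 2ⁿ`
  by the method of multiplicities; Bukh–Chao: `|K| ≥ qⁿ / (2 − 1/q)^{n−1}`, sharp).

## References
* [Dvir2009FiniteFieldKakeya] Z. Dvir, J. Amer. Math. Soc. 22 (2009), no. 4, 1093–1097 —
  definition of a Kakeya set (§1, p. 1093), Definition 1.3, Theorems 1.4 and 1.5 (p. 1094),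
  Lemma 2.1 and the proof of Theorem 1.4 (§2, pp. 1095–1096), proof of Theorem 1.5 (§3,
  p. 1096); arXiv:0803.2336 numbers Theorems 1.4 / 1.5 as Theorems 2 / 3.
-/

namespace Literature.Combinatorics.Kakeya

namespace FiniteFieldKakeya

open MvPolynomial Finset

variable {K : Type*} [Field K]

/-! ### Kakeya sets -/

/-- A **Kakeya set** in `𝔽ⁿ` (Dvir, §1, p. 1093): `S ⊆ 𝔽ⁿ` is a Kakeya set if for every
`v ∈ 𝔽ⁿ` there is a point `b ∈ 𝔽ⁿ` such that the line `{b + a · v | a ∈ 𝔽}` is contained in `S`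
("`S` contains a line in every direction"; as printed, the condition is asked for every `v`,
including `v = 0`). [cite: Dvir2009FiniteFieldKakeya, §1 p. 1093 (definition of a Kakeya set)] -/
def IsKakeya {n : ℕ} (S : Set (Fin n → K)) : Prop :=
  ∀ v : Fin n → K, ∃ b : Fin n → K, ∀ a : K, b + a • v ∈ S

/-- Unfolding lemma for `IsKakeya`. [folklore] -/
theorem isKakeya_iff {n : ℕ} (S : Set (Fin n → K)) :
    IsKakeya S ↔ ∀ v : Fin n → K, ∃ b : Fin n → K, ∀ a : K, b + a • v ∈ S :=
  Iff.rfl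

/-- The whole space is a Kakeya set. [folklore] -/
theorem isKakeya_univ (n : ℕ) : IsKakeya (Set.univ : Set (Fin n → K)) :=
  fun _ => ⟨0, fun _ => Set.mem_univ _⟩

/-- A superset of a Kakeya set is a Kakeya set. [folklore] -/
theorem IsKakeya.mono {n : ℕ} {S T : Set (Fin n → K)} (hS : IsKakeya S) (hST : S ⊆ T) :
    IsKakeya T :=
  fun v => (hS v).imp fun _ hb a => hST (hb a)

/-- A Kakeya set is nonempty (take any direction). [folklore] -/
theorem IsKakeya.nonempty {n : ℕ} {S : Set (Fin n → K)} (hS : IsKakeya S) : S.Nonempty := by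
  obtain ⟨b, hb⟩ := hS 0
  exact ⟨b + (0 : K) • (0 : Fin n → K), hb 0⟩

/-! ### Step 1: a nonzero low-degree polynomial vanishing on a small set -/

/-- **Parameter count.** The space of polynomials of total degree `≤ d` in `n` variables has
dimension at least (in fact exactly) `C(d + n, n)`: the monomials `x^e`, `|e| ≤ d`, are linearly
independent, and they are counted by the exponents `f : Option (Fin n) →₀ ℕ` with `∑ f = d`
(`e = f ∘ some`, the value `f none` being the slack). [folklore] -/
theorem choose_le_finrank_restrictTotalDegree (n d : ℕ) :
    (d + n).choose n ≤ Module.finrank K (restrictTotalDegree (Fin n) K d) := by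
  classical
  set V : Submodule K (MvPolynomial (Fin n) K) := restrictTotalDegree (Fin n) K d with hV
  set A : Finset (Option (Fin n) →₀ ℕ) :=
    (Finset.univ : Finset (Option (Fin n))).finsuppAntidiag d with hA
  have hAsum : ∀ f ∈ A, f none + (f.some.sum fun _ e => e) = d := by
    intro f hf
    rw [hA, Finset.mem_finsuppAntidiag] at hf
    rw [← hf.1, ← Finsupp.sum_fintype f (fun _ e => e) (fun _ => rfl)]
    exact (Finsupp.sum_option_index f (fun _ e => e) (fun _ => rfl) (fun _ _ _ => rfl)).symm
  have hmem : ∀ f ∈ A, MvPolynomial.monomial f.some (1 : K) ∈ V := by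
    intro f hf
    rw [hV, MvPolynomial.mem_restrictTotalDegree]
    refine (MvPolynomial.totalDegree_monomial_le _ _).trans ?_
    have := hAsum f hf
    change (f.some.sum fun _ e => e) ≤ d
    omega
  let b : ↥A → V := fun f => ⟨MvPolynomial.monomial f.1.some 1, hmem f.1 f.2⟩
  have hinj : Function.Injective fun f : ↥A => f.1.some := by
    intro f g h
    apply Subtype.ext
    ext o
    rcases o with _ | i
    · have hf := hAsum f.1 f.2
      have hg := hAsum g.1 g.2
      simp only at h
      rw [h] at hf
      omega
    · simpa only [Finsupp.some_apply] using DFunLike.congr_fun h i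
  have hli : LinearIndependent K b := by
    refine LinearIndependent.of_comp V.subtype ?_
    have : (V.subtype ∘ b) =
        (MvPolynomial.basisMonomials (Fin n) K) ∘ fun f : ↥A => f.1.some := by
      funext f
      simp [b, MvPolynomial.coe_basisMonomials]
    rw [this]
    exact (MvPolynomial.basisMonomials (Fin n) K).linearIndependent.comp _ hinj
  have hcardA : Fintype.card ↥A = (d + n).choose n := by
    rw [Fintype.card_coe, hA, Finset.card_finsuppAntidiag_nat_eq_choose, Finset.card_univ,
      Fintype.card_option, Fintype.card_fin, show n + 1 + d - 1 = d + n by omega,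
      Nat.choose_symm_add]
  rw [← hcardA]
  exact hli.fintype_card_le_finrank

/-- **Interpolation** ("there exists a nonzero polynomial `g` of degree `d ≤ q − 1` so that
`g(x) = 0` for all `x ∈ K`", p. 1096, from `|K| < C(q + n − 1, n)`): if `|S| < C(d + n, n)` then
some nonzero polynomial of total degree `≤ d` vanishes on `S` — the evaluation map from
`{g : deg g ≤ d}` to `K^S` has a kernel. [cite: Dvir2009FiniteFieldKakeya, §3 p. 1096 (proof of
Theorem 1.5)] -/
theorem exists_mvPolynomial_eval_eq_zero {n : ℕ} (S : Finset (Fin n → K)) (d : ℕ)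
    (hcount : S.card < (d + n).choose n) :
    ∃ g : MvPolynomial (Fin n) K, g ≠ 0 ∧ g.totalDegree ≤ d ∧ ∀ x ∈ S, eval x g = 0 := by
  classical
  set V : Submodule K (MvPolynomial (Fin n) K) := restrictTotalDegree (Fin n) K d with hV
  let Ψ : V →ₗ[K] (↥S → K) :=
    (LinearMap.pi fun x : ↥S => (MvPolynomial.aeval (R := K) x.1).toLinearMap).comp V.subtype
  have hW : Module.finrank K (↥S → K) = S.card := by
    rw [Module.finrank_fintype_fun_eq_card, Fintype.card_coe]
  have hlt : Module.finrank K (↥S → K) < Module.finrank K V :=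
    hW ▸ hcount.trans_le (choose_le_finrank_restrictTotalDegree n d)
  obtain ⟨g, hgker, hg0⟩ :=
    (Submodule.ne_bot_iff _).1 (LinearMap.ker_ne_bot_of_finrank_lt (f := Ψ) hlt)
  refine ⟨g.1, fun h => hg0 (Subtype.ext h), (MvPolynomial.mem_restrictTotalDegree _ _ _).1 g.2,
    fun x hx => ?_⟩
  have hΨ : Ψ g = 0 := LinearMap.mem_ker.1 hgker
  have := congr_fun hΨ ⟨x, hx⟩
  simpa [Ψ] using this

/-! ### Step 2: the top coefficient of the restriction to a line -/

/-- The coefficient of top possible degree of a product of polynomials with prescribed degree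
bounds is the product of the corresponding coefficients. [folklore] -/
theorem coeff_prod_of_natDegree_le' {ι : Type*} (s : Finset ι) (f : ι → Polynomial K)
    (e : ι → ℕ) (h : ∀ i ∈ s, (f i).natDegree ≤ e i) :
    (∏ i ∈ s, f i).coeff (∑ i ∈ s, e i) = ∏ i ∈ s, (f i).coeff (e i) := by
  classical
  induction s using Finset.induction_on with
  | empty => simp
  | insert a s ha ih =>
    rw [Finset.prod_insert ha, Finset.sum_insert ha, Finset.prod_insert ha,
      Polynomial.coeff_mul_add_eq_of_natDegree_le (h a (Finset.mem_insert_self a s))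
        ((Polynomial.natDegree_prod_le _ _).trans
          (Finset.sum_le_sum fun i hi => h i (Finset.mem_insert_of_mem hi))),
      ih fun i hi => h i (Finset.mem_insert_of_mem hi)]

/-- The coefficient of `t^d` in `∏ᵢ (zᵢ + yᵢ t)^{sᵢ}` is `∏ᵢ yᵢ^{sᵢ}` if `|s| = d` and `0` if
`|s| < d`. [folklore] -/
theorem coeff_prod_linear_pow {n : ℕ} (z y : Fin n → K) (s : Fin n →₀ ℕ) {d : ℕ}
    (hs : s.degree ≤ d) :
    (∏ i ∈ s.support, (Polynomial.C (z i) + Polynomial.C (y i) * Polynomial.X) ^ s i).coeff d =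
      if s.degree = d then ∏ i ∈ s.support, y i ^ s i else 0 := by
  have h1 : ∀ i, (Polynomial.C (z i) + Polynomial.C (y i) * Polynomial.X).natDegree ≤ 1 := by
    intro i
    refine (Polynomial.natDegree_add_le _ _).trans (max_le ?_ ?_)
    · rw [Polynomial.natDegree_C]
      exact Nat.zero_le _
    · exact (Polynomial.natDegree_C_mul_le _ _).trans Polynomial.natDegree_X_le
  have hpow : ∀ i, ((Polynomial.C (z i) + Polynomial.C (y i) * Polynomial.X) ^ s i).natDegree
      ≤ s i := fun i =>
    (Polynomial.natDegree_pow_le_of_le (s i) (h1 i)).trans (mul_one _).le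
  split_ifs with hd
  · rw [← hd, Finsupp.degree_apply, coeff_prod_of_natDegree_le' _ _ _ fun i _ => hpow i]
    refine Finset.prod_congr rfl fun i _ => ?_
    have h := Polynomial.coeff_pow_of_natDegree_le (m := s i) (h1 i)
    rw [mul_one] at h
    rw [h]
    simp
  · refine Polynomial.coeff_eq_zero_of_natDegree_lt ?_
    refine ((Polynomial.natDegree_prod_le _ _).trans (Finset.sum_le_sum fun i _ => hpow i))
      |>.trans_lt ?_
    rw [← Finsupp.degree_apply]
    exact lt_of_le_of_ne hs hd

/-- **"The coefficient of `t^d` is exactly `ḡ(y)`"** (p. 1096): for `d ≥ deg g`, the coefficient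
of `t^d` in the restriction `P_{y,z}(t) = g(z + t y)` of `g` to the line through `z` in direction
`y` is the value at `y` of the degree-`d` homogeneous part `ḡ` of `g`.
[cite: Dvir2009FiniteFieldKakeya, §3 p. 1096 (proof of Theorem 1.5)] -/
theorem coeff_aeval_line {n : ℕ} (z y : Fin n → K) (g : MvPolynomial (Fin n) K) {d : ℕ}
    (hd : g.totalDegree ≤ d) :
    (MvPolynomial.aeval (fun i => Polynomial.C (z i) + Polynomial.C (y i) * Polynomial.X)
      g).coeff d = eval y (homogeneousComponent d g) := by
  classical
  rw [MvPolynomial.aeval_eq_eval₂Hom, MvPolynomial.coe_eval₂Hom, MvPolynomial.eval₂_eq,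
    Polynomial.finsetSum_coeff, homogeneousComponent_apply, map_sum, Finset.sum_filter]
  refine Finset.sum_congr rfl fun s hs => ?_
  have hsd : s.degree ≤ d := (MvPolynomial.le_totalDegree hs).trans hd
  rw [Polynomial.algebraMap_eq, Polynomial.coeff_C_mul, coeff_prod_linear_pow z y s hsd,
    MvPolynomial.eval_monomial]
  split_ifs with h
  · rfl
  · rw [mul_zero]

/-! ### Step 3: the top homogeneous part, and nonvanishing of low-degree polynomials -/

/-- "`ḡ` is nonzero": the homogeneous part of degree `deg g` of a nonzero polynomial `g` is
nonzero. [folklore] -/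
theorem homogeneousComponent_totalDegree_ne_zero {σ : Type*} {g : MvPolynomial σ K}
    (hg : g ≠ 0) : homogeneousComponent g.totalDegree g ≠ 0 := by
  classical
  obtain ⟨s, hs, hdeg⟩ := Finset.exists_mem_eq_sup _ (support_nonempty.mpr hg)
    (fun s : σ →₀ ℕ => s.sum fun _ e => e)
  intro h
  have hc := congrArg (coeff s) h
  rw [coeff_homogeneousComponent, if_pos (by rw [Finsupp.degree_apply]; exact hdeg.symm),
    coeff_zero] at hc
  exact (mem_support_iff.mp hs) hc

/-- **A nonzero polynomial of total degree `< q` over `𝔽_q` does not vanish at every point of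
`𝔽_qⁿ`** (the step "`ḡ(y) = 0` for every `y` ⟹ `ḡ ≡ 0`" of p. 1096, valid because `d ≤ q − 1`;
here from the Schwartz–Zippel lemma, Dvir's Lemma 2.1: at most `d · q^{n−1} < qⁿ` zeros).
[cite: Dvir2009FiniteFieldKakeya, Lemma 2.1 (p. 1095)] -/
theorem exists_eval_ne_zero_of_totalDegree_lt [Fintype K] {n : ℕ} {p : MvPolynomial (Fin n) K}
    (hp : p ≠ 0) (hdeg : p.totalDegree < Fintype.card K) : ∃ x : Fin n → K, eval x p ≠ 0 := by
  classical
  by_contra! h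
  have sz := MvPolynomial.schwartz_zippel_totalDegree hp (Finset.univ : Finset K)
  have hfilter : (Fintype.piFinset fun _ : Fin n => (Finset.univ : Finset K)).filter
      (fun f => eval f p = 0) = Fintype.piFinset fun _ : Fin n => (Finset.univ : Finset K) :=
    Finset.filter_true_of_mem fun f _ => h f
  rw [hfilter, Fintype.card_piFinset, Finset.prod_const, Finset.card_univ, Finset.card_univ,
    Fintype.card_fin, Nat.cast_pow,
    div_self (pow_ne_zero _ (Nat.cast_ne_zero.mpr Fintype.card_ne_zero)),
    le_div_iff₀ (Nat.cast_pos.mpr Fintype.card_pos), one_mul, Nat.cast_le] at sz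
  exact absurd sz (not_le.mpr hdeg)

/-! ### Theorem 1.5 -/

/-- **Dvir's finite-field Kakeya theorem (Theorem 1.5), explicit form of the printed proof:**
every Kakeya set `S ⊆ 𝔽_qⁿ` satisfies `|S| ≥ C(q + n − 1, n)`.  Proof as printed (§3, p. 1096):
otherwise a nonzero `g` of degree `d ≤ q − 1` vanishes on `S`; for every direction `y` the
restriction of `g` to a line `{z + t y} ⊆ S` vanishes identically (degree `< q`), so its `t^d`
coefficient `ḡ(y)` vanishes; hence `ḡ` vanishes everywhere, contradicting `ḡ ≠ 0`, `deg ḡ < q`.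
[cite: Dvir2009FiniteFieldKakeya, Theorem 1.5 (p. 1094; proof §3 p. 1096)] -/
theorem choose_le_card [Fintype K] {n : ℕ} {S : Finset (Fin n → K)}
    (hS : IsKakeya (↑S : Set (Fin n → K))) : (Fintype.card K + n - 1).choose n ≤ S.card := by
  classical
  set q := Fintype.card K with hq
  have hq1 : 1 ≤ q := Fintype.card_pos
  by_contra! hlt
  obtain ⟨g, hg0, hdeg, hvan⟩ := exists_mvPolynomial_eval_eq_zero S (q - 1)
    (by rwa [show q - 1 + n = q + n - 1 by omega])
  set d := g.totalDegree with hd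
  have hbar0 : homogeneousComponent d g ≠ 0 := homogeneousComponent_totalDegree_ne_zero hg0
  have hbardeg : (homogeneousComponent d g).totalDegree < q :=
    (homogeneousComponent_isHomogeneous d g).totalDegree_le.trans_lt (by omega)
  obtain ⟨y, hy⟩ := exists_eval_ne_zero_of_totalDegree_lt hbar0 hbardeg
  obtain ⟨z, hz⟩ := hS y
  have hR : MvPolynomial.aeval
      (fun i => Polynomial.C (z i) + Polynomial.C (y i) * Polynomial.X) g = 0 :=
    Extremal.aeval_line_eq_zero_of_totalDegree_lt_card z y g Finset.univ
      (by rw [Finset.card_univ]; omega) fun t _ => hvan _ (Finset.mem_coe.mp (hz t))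
  have hcoeff := coeff_aeval_line z y g le_rfl
  rw [hR, Polynomial.coeff_zero] at hcoeff
  exact hy hcoeff.symm

/-- **Theorem 1.5 with the constant `C_n = 1 / n!`:** every Kakeya set `S ⊆ 𝔽_qⁿ` satisfies
`qⁿ ≤ n! · |S|` (from `choose_le_card` and `n! · C(q + n − 1, n) = q (q + 1) ⋯ (q + n − 1) ≥ qⁿ`).
[cite: Dvir2009FiniteFieldKakeya, Theorem 1.5 (p. 1094)] -/
theorem pow_le_factorial_mul_card [Fintype K] {n : ℕ} {S : Finset (Fin n → K)}
    (hS : IsKakeya (↑S : Set (Fin n → K))) : Fintype.card K ^ n ≤ n.factorial * S.card :=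
  calc Fintype.card K ^ n ≤ (Fintype.card K).ascFactorial n := Nat.pow_succ_le_ascFactorial _ n
    _ = n.factorial * (Fintype.card K + n - 1).choose n :=
      Nat.ascFactorial_eq_factorial_mul_choose' _ n
    _ ≤ n.factorial * S.card := Nat.mul_le_mul_left _ (choose_le_card hS)

/-- Theorem 1.5 for a `Set`: every Kakeya set `S ⊆ 𝔽_qⁿ` has at least `C(q + n − 1, n)` elements.
[cite: Dvir2009FiniteFieldKakeya, Theorem 1.5 (p. 1094; proof §3 p. 1096)] -/
theorem choose_le_ncard [Fintype K] {n : ℕ} {S : Set (Fin n → K)} (hS : IsKakeya S) :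
    (Fintype.card K + n - 1).choose n ≤ S.ncard := by
  classical
  rw [Set.ncard_eq_toFinset_card' S]
  exact choose_le_card (by rwa [Set.coe_toFinset])

/-- Theorem 1.5 for a `Set`, with the constant `C_n = 1 / n!`: `qⁿ ≤ n! · |S|`.
[cite: Dvir2009FiniteFieldKakeya, Theorem 1.5 (p. 1094)] -/
theorem pow_le_factorial_mul_ncard [Fintype K] {n : ℕ} {S : Set (Fin n → K)} (hS : IsKakeya S) :
    Fintype.card K ^ n ≤ n.factorial * S.ncard := by
  classical
  rw [Set.ncard_eq_toFinset_card' S]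
  exact pow_le_factorial_mul_card (by rwa [Set.coe_toFinset])

/-! ### Theorem 1.4: `(δ, γ)`-Kakeya sets -/

section DeltaGamma

/-- A **`(δ, γ)`-Kakeya set** (Dvir, Definition 1.3, p. 1094): `S ⊆ 𝔽ⁿ` is a `(δ, γ)`-Kakeya set
if there exists a set `ℒ ⊆ 𝔽ⁿ` of size at least `δ · qⁿ` such that for every `x ∈ ℒ` there is a
line in direction `x`, `L_{z,x} = {z + a · x | a ∈ 𝔽}`, that intersects `S` in at least `γ · q`
points.  (Transcribed as printed, with `ℒ` a finite set of vectors and the intersection counted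
as a set of points; for `x = 0` the line `L_{z,0} = {z}` meets `S` in at most one point.)
[cite: Dvir2009FiniteFieldKakeya, Definition 1.3 (p. 1094)] -/
def IsDeltaGammaKakeya [Fintype K] {n : ℕ} (δ γ : ℝ) (S : Set (Fin n → K)) : Prop :=
  ∃ L : Finset (Fin n → K), δ * (Fintype.card K : ℝ) ^ n ≤ L.card ∧
    ∀ x ∈ L, ∃ z : Fin n → K,
      γ * (Fintype.card K : ℝ) ≤ ((Set.range fun a : K => z + a • x) ∩ S).ncard

/-- Unfolding lemma for `IsDeltaGammaKakeya`. [folklore] -/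
theorem isDeltaGammaKakeya_iff [Fintype K] {n : ℕ} (δ γ : ℝ) (S : Set (Fin n → K)) :
    IsDeltaGammaKakeya δ γ S ↔
      ∃ L : Finset (Fin n → K), δ * (Fintype.card K : ℝ) ^ n ≤ L.card ∧
        ∀ x ∈ L, ∃ z : Fin n → K,
          γ * (Fintype.card K : ℝ) ≤ ((Set.range fun a : K => z + a • x) ∩ S).ncard :=
  Iff.rfl

/-- A superset of a `(δ, γ)`-Kakeya set is a `(δ, γ)`-Kakeya set. [folklore] -/
theorem IsDeltaGammaKakeya.mono [Fintype K] {n : ℕ} {δ γ : ℝ} {S T : Set (Fin n → K)}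
    (hS : IsDeltaGammaKakeya δ γ S) (hST : S ⊆ T) : IsDeltaGammaKakeya δ γ T := by
  obtain ⟨L, hL, h⟩ := hS
  refine ⟨L, hL, fun x hx => ?_⟩
  obtain ⟨z, hz⟩ := h x hx
  refine ⟨z, hz.trans ?_⟩
  exact_mod_cast Set.ncard_le_ncard (Set.inter_subset_inter_right _ hST) (Set.toFinite _)

/-- The number of points of the line `{z + a x}` lying in `S` is at most the number of parameters
`a` with `z + a x ∈ S`. [folklore] -/
theorem ncard_range_inter_le [Fintype K] [DecidableEq K] {n : ℕ} (z x : Fin n → K)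
    (S : Finset (Fin n → K)) :
    ((Set.range fun a : K => z + a • x) ∩ ↑S).ncard ≤
      (Finset.univ.filter fun a : K => z + a • x ∈ S).card := by
  have h : (Set.range fun a : K => z + a • x) ∩ ↑S =
      (fun a : K => z + a • x) '' ↑(Finset.univ.filter fun a : K => z + a • x ∈ S) := by
    ext p
    simp only [Set.mem_inter_iff, Set.mem_range, Finset.mem_coe, Set.mem_image, Finset.mem_filter,
      Finset.mem_univ, true_and]
    constructor
    · rintro ⟨⟨a, rfl⟩, hp⟩
      exact ⟨a, hp, rfl⟩
    · rintro ⟨a, ha, rfl⟩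
      exact ⟨⟨a, rfl⟩, ha⟩
  rw [h, ← Set.ncard_coe_finset (Finset.univ.filter fun a : K => z + a • x ∈ S)]
  exact Set.ncard_image_le (Finset.finite_toSet _)

/-- **Homogeneous interpolation** ("there exists a homogeneous degree `d` polynomial `g` … such
that `g` is not the zero polynomial and `∀ x ∈ K, g(x) = 0`", p. 1095, from
`|K| < C(d + n − 1, n − 1)` = the number of monomials of degree `d`): if `|S|` is less than the
number `C(n + d − 1, d)` of monomials of degree `d` in `n` variables, some nonzero homogeneous
polynomial of degree `d` vanishes on `S`. [cite: Dvir2009FiniteFieldKakeya, §2 p. 1095 (proof of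
Theorem 1.4)] -/
theorem exists_isHomogeneous_eval_eq_zero {n : ℕ} (S : Finset (Fin n → K)) (d : ℕ)
    (hcount : S.card < (n + d - 1).choose d) :
    ∃ g : MvPolynomial (Fin n) K, g ≠ 0 ∧ g.IsHomogeneous d ∧ ∀ x ∈ S, eval x g = 0 := by
  classical
  set A : Finset (Fin n →₀ ℕ) := (Finset.univ : Finset (Fin n)).finsuppAntidiag d with hA
  have hAdeg : ∀ e ∈ A, e.degree = d := by
    intro e he
    rw [hA, Finset.mem_finsuppAntidiag] at he
    rw [Finsupp.degree_eq_sum]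
    exact he.1
  have hcardA : Fintype.card ↥A = (n + d - 1).choose d := by
    rw [Fintype.card_coe, hA, Finset.card_finsuppAntidiag_nat_eq_choose, Finset.card_univ,
      Fintype.card_fin]
  let G : (↥A → K) →ₗ[K] MvPolynomial (Fin n) K :=
    ∑ e : ↥A, (monomial e.1).comp (LinearMap.proj e)
  have hG : ∀ c : ↥A → K, G c = ∑ e : ↥A, monomial e.1 (c e) := by
    intro c
    simp [G, LinearMap.sum_apply]
  let Ψ : (↥A → K) →ₗ[K] (↥S → K) :=
    (LinearMap.pi fun x : ↥S => (MvPolynomial.aeval (R := K) x.1).toLinearMap).comp G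
  have hlt : Module.finrank K (↥S → K) < Module.finrank K (↥A → K) := by
    rw [Module.finrank_fintype_fun_eq_card, Module.finrank_fintype_fun_eq_card, Fintype.card_coe,
      hcardA]
    exact hcount
  obtain ⟨c, hcker, hc0⟩ :=
    (Submodule.ne_bot_iff _).1 (LinearMap.ker_ne_bot_of_finrank_lt (f := Ψ) hlt)
  refine ⟨G c, fun h0 => hc0 ?_, ?_, fun x hx => ?_⟩
  · funext e
    have hc := congrArg (coeff e.1) h0
    rw [hG, coeff_sum, coeff_zero, Finset.sum_eq_single e] at hc
    · simpa using hc
    · intro b _ hb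
      rw [coeff_monomial, if_neg fun h => hb (Subtype.ext h)]
    · exact fun h => absurd (Finset.mem_univ e) h
  · rw [hG]
    exact IsHomogeneous.sum _ _ _ fun e _ => isHomogeneous_monomial _ (hAdeg e.1 e.2)
  · have := congr_fun (LinearMap.mem_ker.1 hcker) ⟨x, hx⟩
    simpa [Ψ] using this

/-- For `g` homogeneous of degree `d`, the coefficient of `t^d` in `g(z + t y)` is `g(y)` (the
top-coefficient computation of §3 applied to a homogeneous `g = ḡ`). [folklore] -/
theorem coeff_aeval_line_of_isHomogeneous {n : ℕ} (z y : Fin n → K) {g : MvPolynomial (Fin n) K}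
    {d : ℕ} (hg : g.IsHomogeneous d) :
    (MvPolynomial.aeval (fun i => Polynomial.C (z i) + Polynomial.C (y i) * Polynomial.X)
      g).coeff d = eval y g := by
  rw [coeff_aeval_line z y g hg.totalDegree_le, homogeneousComponent_eq_self hg]

/-- **Schwartz–Zippel** (Dvir's Lemma 2.1, p. 1095: a nonzero `f` with `deg f ≤ d` has at most
`d · q^{n−1}` zeros in `𝔽ⁿ`), in the form `#{x : g(x) = 0} · q ≤ deg g · qⁿ`; from Mathlib's
`MvPolynomial.schwartz_zippel_totalDegree`. [cite: Dvir2009FiniteFieldKakeya, Lemma 2.1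
(p. 1095)] -/
theorem card_zeros_mul_card_le [Fintype K] [DecidableEq K] {n : ℕ} {g : MvPolynomial (Fin n) K}
    (hg : g ≠ 0) :
    (Finset.univ.filter fun x : Fin n → K => eval x g = 0).card * Fintype.card K ≤
      g.totalDegree * Fintype.card K ^ n := by
  classical
  have sz := MvPolynomial.schwartz_zippel_totalDegree hg (Finset.univ : Finset K)
  rw [Fintype.piFinset_univ, Finset.card_univ,
    div_le_div_iff₀ (pow_pos (Nat.cast_pos.mpr Fintype.card_pos) _)
      (Nat.cast_pos.mpr Fintype.card_pos)] at sz
  exact_mod_cast sz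

/-- **Dvir's Theorem 1.4** (p. 1094), for every admissible `d`: if `S ⊆ 𝔽_qⁿ` is a
`(δ, γ)`-Kakeya set and `d + 2 ≤ q · min{δ, γ}`, then `|S| ≥ C(d + n − 1, n − 1)` (the printed
statement takes the largest such `d`, `d = ⌊q min{δ, γ}⌋ − 2`: `choose_floor_le_card`).  Proof
(§2, pp. 1095–1096): otherwise a nonzero homogeneous `g` of degree `d` vanishes on `S`; for
`x ∈ ℒ` the restriction of `g` to a line `{z + a x}` meeting `S` in `≥ γ q ≥ d + 2 > d` points
vanishes identically, so its `a^d`-coefficient `g(x)` vanishes (this replaces the printed cone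
`K' = {c x}` / inversion argument of Claim 2.2 by the top-coefficient argument of §3); thus `g` has
at least `|ℒ| ≥ δ qⁿ` zeros, contradicting Lemma 2.1 (`≤ d q^{n−1}` zeros) as `d < δ q`.
[cite: Dvir2009FiniteFieldKakeya, Theorem 1.4 (p. 1094; proof §2 pp. 1095–1096)] -/
theorem choose_le_card_of_isDeltaGammaKakeya [Fintype K] {n d : ℕ} {δ γ : ℝ}
    {S : Finset (Fin n → K)} (hS : IsDeltaGammaKakeya δ γ (↑S : Set (Fin n → K)))
    (hδ : (d : ℝ) + 2 ≤ δ * Fintype.card K) (hγ : (d : ℝ) + 2 ≤ γ * Fintype.card K) :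
    (d + n - 1).choose (n - 1) ≤ S.card := by
  classical
  obtain ⟨L, hLcard, hL⟩ := hS
  set q := Fintype.card K with hq
  have hq0 : (0 : ℝ) < q := Nat.cast_pos.mpr Fintype.card_pos
  -- every direction in `ℒ` carries at least `d + 2` parameters `a` with `z + a x ∈ S`
  have hT : ∀ x ∈ L, ∃ z : Fin n → K,
      d + 2 ≤ (Finset.univ.filter fun a : K => z + a • x ∈ S).card := by
    intro x hx
    obtain ⟨z, hz⟩ := hL x hx
    refine ⟨z, ?_⟩
    have h := hz.trans (Nat.cast_le.mpr (ncard_range_inter_le z x S))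
    exact_mod_cast hγ.trans h
  -- `ℒ` is nonempty (`δ > 0`)
  have hδ0 : 0 < δ := by
    have : (0 : ℝ) < δ * q := by linarith [(Nat.cast_nonneg d : (0 : ℝ) ≤ d)]
    exact pos_of_mul_pos_left this hq0.le  -- δ * q > 0, q ≥ 0 ⇒ δ > 0
  have hLne : L.Nonempty := by
    rw [← Finset.card_pos, ← Nat.cast_pos (α := ℝ)]
    exact lt_of_lt_of_le (mul_pos hδ0 (pow_pos hq0 n)) hLcard
  rcases Nat.eq_zero_or_pos n with rfl | hn
  · -- `n = 0`: the bound is `1`, and `S` is nonempty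
    obtain ⟨x, hx⟩ := hLne
    obtain ⟨z, hz⟩ := hT x hx
    have hpos : 0 < (Finset.univ.filter fun a : K => z + a • x ∈ S).card := by omega
    obtain ⟨a, ha⟩ := Finset.card_pos.mp hpos
    rw [Finset.mem_filter] at ha
    simpa using Finset.card_pos.mpr ⟨_, ha.2⟩
  -- `n ≥ 1`: the polynomial argument
  rw [show (d + n - 1).choose (n - 1) = (n + d - 1).choose d by
    rw [show n + d - 1 = d + n - 1 by omega, ← Nat.choose_symm (show d ≤ d + n - 1 by omega),
      show d + n - 1 - d = n - 1 by omega]]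
  by_contra! hlt
  obtain ⟨g, hg0, hghom, hvan⟩ := exists_isHomogeneous_eval_eq_zero S d hlt
  -- `g` vanishes on `ℒ`
  have hzero : ∀ x ∈ L, eval x g = 0 := by
    intro x hx
    obtain ⟨z, hz⟩ := hT x hx
    have hR : MvPolynomial.aeval
        (fun i => Polynomial.C (z i) + Polynomial.C (x i) * Polynomial.X) g = 0 :=
      Extremal.aeval_line_eq_zero_of_totalDegree_lt_card z x g
        (Finset.univ.filter fun a : K => z + a • x ∈ S)
        (hghom.totalDegree_le.trans_lt (by omega))
        fun a ha => hvan _ (Finset.mem_filter.mp ha).2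
    have hc := coeff_aeval_line_of_isHomogeneous z x hghom
    rw [hR, Polynomial.coeff_zero] at hc
    exact hc.symm
  -- count: `δ qⁿ ≤ |ℒ| ≤ #zeros` and `#zeros · q ≤ d · qⁿ`
  have hLZ : L.card ≤ (Finset.univ.filter fun x : Fin n → K => eval x g = 0).card :=
    Finset.card_le_card fun x hx => Finset.mem_filter.mpr ⟨Finset.mem_univ _, hzero x hx⟩
  have hSZ := card_zeros_mul_card_le hg0
  have hdeg : g.totalDegree ≤ d := hghom.totalDegree_le
  have h1 : δ * (q : ℝ) ^ n * q ≤ (d : ℝ) * (q : ℝ) ^ n := by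
    calc δ * (q : ℝ) ^ n * q ≤ (L.card : ℝ) * q := by gcongr
      _ ≤ ((Finset.univ.filter fun x : Fin n → K => eval x g = 0).card : ℝ) * q := by gcongr
      _ ≤ (g.totalDegree : ℝ) * (q : ℝ) ^ n := by exact_mod_cast hSZ
      _ ≤ (d : ℝ) * (q : ℝ) ^ n := by gcongr
  have h2 : δ * q ≤ d := le_of_mul_le_mul_right (by linarith [h1]) (pow_pos hq0 n)
  linarith

/-- **Dvir's Theorem 1.4 as printed** (p. 1094): a `(δ, γ)`-Kakeya set `S ⊆ 𝔽_qⁿ` has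
`|S| ≥ C(d + n − 1, n − 1)` with `d = ⌊q · min{δ, γ}⌋ − 2` (here for `q · min{δ, γ} ≥ 2`, so that
`d ≥ 0` is an honest integer; for smaller `δ, γ` the printed bound is vacuous).
[cite: Dvir2009FiniteFieldKakeya, Theorem 1.4 (p. 1094)] -/
theorem choose_floor_le_card_of_isDeltaGammaKakeya [Fintype K] {n : ℕ} {δ γ : ℝ}
    {S : Finset (Fin n → K)} (hS : IsDeltaGammaKakeya δ γ (↑S : Set (Fin n → K)))
    (h2 : 2 ≤ (Fintype.card K : ℝ) * min δ γ) :
    (⌊(Fintype.card K : ℝ) * min δ γ⌋₊ - 2 + n - 1).choose (n - 1) ≤ S.card := by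
  set m : ℝ := (Fintype.card K : ℝ) * min δ γ with hm
  have hm0 : 0 ≤ m := le_trans (by norm_num) h2
  have hfl : (2 : ℕ) ≤ ⌊m⌋₊ := Nat.le_floor (by exact_mod_cast h2)
  have hcast : ((⌊m⌋₊ - 2 : ℕ) : ℝ) + 2 = ⌊m⌋₊ := by
    rw [Nat.cast_sub hfl]
    push_cast
    ring
  have hle : ((⌊m⌋₊ - 2 : ℕ) : ℝ) + 2 ≤ m := hcast ▸ Nat.floor_le hm0
  refine choose_le_card_of_isDeltaGammaKakeya hS (hle.trans ?_) (hle.trans ?_)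
  · rw [hm, mul_comm]
    exact mul_le_mul_of_nonneg_right (min_le_left _ _) (Nat.cast_nonneg _)
  · rw [hm, mul_comm]
    exact mul_le_mul_of_nonneg_right (min_le_right _ _) (Nat.cast_nonneg _)

/-- Theorem 1.4 for a `Set`. [cite: Dvir2009FiniteFieldKakeya, Theorem 1.4 (p. 1094)] -/
theorem choose_le_ncard_of_isDeltaGammaKakeya [Fintype K] {n d : ℕ} {δ γ : ℝ}
    {S : Set (Fin n → K)} (hS : IsDeltaGammaKakeya δ γ S)
    (hδ : (d : ℝ) + 2 ≤ δ * Fintype.card K) (hγ : (d : ℝ) + 2 ≤ γ * Fintype.card K) :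
    (d + n - 1).choose (n - 1) ≤ S.ncard := by
  classical
  rw [Set.ncard_eq_toFinset_card' S]
  exact choose_le_card_of_isDeltaGammaKakeya (by rwa [Set.coe_toFinset]) hδ hγ

end DeltaGamma

end FiniteFieldKakeya

end Literature.Combinatorics.Kakeya
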